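import Summits.QuantumFields.BalabanUV.T4Continuum.Support.RegionExteriorFlux
import Summits.QuantumFields.BalabanUV.T4Continuum.Support.InverseComparison

/-!
# T⁴ programme, spine node NE2 (U1a), sub-row Δ1 «NE2⁰-Dirichlet» — THE CORNER COUPLING OF THE ELECTRIC OPERATOR ON AN ARBITRARY UNION
# OF BLOCKS, QUANTIFIED: `re⟨A, C A⟩ ≤ n²·Σ_corner ‖A‖²`, `re⟨A, C A⟩ ≥ −(d − 1)·n²·Σ_corner ‖A‖²`, `‖C‖ ≤ (d − 1)·n²` (`2 ≤ n`), the corner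
# bonds being the star bonds attached to an exterior site with at least two `Ω`-neighbours

NE2 formalisation swarm `b2b-balaban-t4-ne2-formalise-*`, LEAF PROVER 02 (gen 9), support item «Δ1-CORNER-COUPLING», file 2 of 2 (file 1
`Support/RegionExteriorFlux`: `nbrCount`, the boundary weight `bdW`, two-sided exterior-flux bounds).  The located successor estimate of this
lineage — gen 8's file 6 `Support/RegionElectricGeneral` (p240775) typed the corner coupling `cornerC = diag(n²·cnt1 (b.2) b) − E·Eᴴ` of the local
electric operator, `curlRᴴcurlR + gradR·gradRᴴ = Σ_μ W_μ + C` on EVERY union of blocks (`electric_general`), proved `C = 0` under H1 and left «its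
norm `≍ n²` on [the contact] set is the successor's estimate»; the row-NE2 owner's ruling R37 (e) (journal 2026-08-20 l.22730) lists it as item (i)
of the NEXT FRONT «regions with RE-ENTRANT CONTACT»: «`Δ_loc` is NO LONGER COMPONENTWISE — the exterior-flux block `E·Eᴴ` couples the two normal
star bonds of different components at every re-entrant exterior site (‖n²·C‖ ≍ n², supported on the codimension-2 contact set)».  THIS FILE
proves it, with sharp constants:

 * §0 **`opNorm_le_of_re_form_two_sided`** — form ⇒ norm for an INDEFINITE Hermitian matrix: `−K‖v‖² ≤ re⟨v, Yv⟩ ≤ K‖v‖²` for all `v` gives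
   `‖Y‖ ≤ K` (polarization `4t·‖Yv‖² = Q(Yv + tv) − Q(Yv − tv) ≤ 2K(‖Yv‖² + t²‖v‖²)` at `t = K`; the tree's `InverseComparison.opNorm_le_of_form_le`
   needs `Y ≥ 0`).
 * §1 **THE CORNER WEIGHT** `cornerWt b = bdW [2 ≤ nbrCount] b` — the number of exterior endpoints of `b` with at least two `Ω`-neighbours; `0` or
   `1` on a star bond (`cornerWt_le_one`); `0` everywhere under H1 (`cornerWt_eq_zero_of_atMostOne`) — and the weights-form bounds valid for
   every `n` (`form_cornerC_le_weights` / `form_cornerC_ge_weights`, from file 1's flux bounds and file 6's `form_cornerC`).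
 * §2 at `2 ≤ n` the own-direction charge IS the boundary indicator — **`cnt1_own_eq_bdW`** `cnt1 (y.2) y = [head ∉ Ω] + [tail ∉ Ω]` with NO H1
   (gen 8's `cnt1_own_eq` assumed H1; here `not_nbr_both` replaces it) — hence THE ENDS on any union of blocks:
   **`form_cornerC_le (hn : 2 ≤ n) : re⟨A, C A⟩ ≤ n²·Σ_y cornerWt y·‖A y‖²`**,
   **`form_cornerC_ge (hn : 2 ≤ n) : −(d − 1)·n²·Σ_y cornerWt y·‖A y‖² ≤ re⟨A, C A⟩`** (truncated `d − 1`; uses `nbrCount ≤ d`),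
   **`opNorm_cornerC_le (hn : 2 ≤ n) : ‖cornerC n M S‖ ≤ (d − 1)·n²`** (for `d ≤ 1` there is no corner and `C = 0`).
   READING.  The quadratic form of the non-componentwise part of `Δ_loc = Σ_μ W_μ + C + a n^d·avgRᴴavgR` lives on the corner bonds only, between
   `−(d − 1)·n²` and `+n²` per unit mass there, and `‖C‖ ≤ (d − 1)·n²`; both signs occur (at an exterior site with `m ≥ 2` attached star bonds the
   block of `C` is `−n²·(s sᴴ − diag)`, `s` the sign vector, eigenvalues `−(m − 1)n²` and `+n²` — prose; the entrywise support statement is not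
   typed here).

 * §3 a consequence for item (ii) (W2) of the same front: **`extFlux_le_boundary`** `extFlux A ≤ d·n²·Σ_y bdW 1 y·‖A y‖²` and
   **`gradEnergy_le_boundary`** `Σ_ν ‖∇_ν ιA‖² ≤ ‖curlR A‖² + ‖gradRᴴA‖² + d·n²·Σ_y bdW 1 y·‖A y‖²` (`2 ≤ n`, ANY union of blocks): a
   linear-growth zero-extension W2 constant follows from one trace-type bound on the boundary-normal mass, with no corner condition
   (and conversely up to corners, `isolated_boundary_le_gradEnergy`).

HONEST FRAMING (T4-DAG p. 1).  Lattice bookkeeping at MODEL level (`U = 1`, ONE region, finite torus); statements and constants OURS ([folklore]);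
this quantifies obstruction (i) of the re-entrant front (and reduces (ii) to a trace bound) ONLY — no Hessian budget, no W2, no two-level law and no tower on re-entrant regions is
claimed; W3 on boxes OPEN; Δ1 NOT closed; NE2 (U1a) NOT proved; spine PROVED 0/9 unchanged; NOT [B9] (3.16)/(3.23)–(3.27) as printed; NOT infinite
volume, NOT a mass gap, NOT the Clay problem.  HONEST DEPENDENCY: continuum YM on T⁴ ⇐ BetaPertH ∧ nine spine estimates (0/9 proved); BetaPertH ⇐
(D1) ∧ (D4) ∧ CAP+tail; G-an2-4 gates asym, D1 and NE2/3/4.  No `sorry`.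
-/

noncomputable section

open scoped BigOperators ComplexConjugate Matrix Matrix.Norms.L2Operator
open Finset

namespace Summit.QuantumFields.BalabanUV.T4Continuum.RegionCornerCoupling

open Literature.MathematicalPhysics.QuantumFieldTheory.Balaban1983to89.B5Prop11Plancherel (Tor fine fdiff unitVec)
open Literature.MathematicalPhysics.QuantumFieldTheory.Balaban1983to89.B5Prop11Lower (nsq nsq_nonneg star_dotProduct_self)
open Summit.QuantumFields.BalabanUV.T4Continuum
open Summit.QuantumFields.BalabanUV.T4Continuum.SubtypeCompression (ext)
open Summit.QuantumFields.BalabanUV.T4Continuum.RegionGaugeFixedVector (starReg curlR gradR)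
open Summit.QuantumFields.BalabanUV.T4Continuum.RegionGaffneyIdentity (extFlux gaffney_region)
open Summit.QuantumFields.BalabanUV.T4Continuum.RegionStarBoundaryCharges (AtMostOneNeighbour)
open Summit.QuantumFields.BalabanUV.T4Continuum.RegionElectricSplitting (cnt1)
open Summit.QuantumFields.BalabanUV.T4Continuum.RegionElectricGeneral (cornerC cornerC_isHermitian form_cornerC cornerC_eq_zero)
open Summit.QuantumFields.BalabanUV.T4Continuum.RegionExteriorFlux
open Summit.QuantumFields.BalabanUV.T4Continuum.InverseComparison (re_form_sub_smul)
open Summit.QuantumFields.BalabanUV.T4Continuum.ScalarAveragedPropagator (opNorm_le_of_nsq_le_rect)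
open Summit.QuantumFields.BalabanUV.Beta.GAN24.DirichletBoxTrace (blockReg)

variable {d : ℕ}

/-! ## §0 Form ⇒ norm for an indefinite Hermitian matrix -/

/-- **FORM ⇒ NORM FOR AN INDEFINITE HERMITIAN MATRIX**: if `−K·‖v‖² ≤ re⟨v, Yv⟩ ≤ K·‖v‖²` for all `v`, then `‖Y‖ ≤ K`
(polarization at `u = Yv`: `4t·‖u‖² = Q(u + tv) − Q(u − tv) ≤ K‖u + tv‖² + K‖u − tv‖² = 2K(‖u‖² + t²‖v‖²)`, then `t = K`). [folklore] -/
theorem opNorm_le_of_re_form_two_sided {m : Type*} [Fintype m] [DecidableEq m] {Y : Matrix m m ℂ} (hY : Y.IsHermitian) {K : ℝ}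
    (hK : 0 ≤ K) (hup : ∀ v, (star v ⬝ᵥ (Y *ᵥ v)).re ≤ K * nsq v) (hlo : ∀ v, -(K * nsq v) ≤ (star v ⬝ᵥ (Y *ᵥ v)).re) :
    ‖Y‖ ≤ K := by
  refine opNorm_le_of_nsq_le_rect Y hK fun v => ?_
  set u := Y *ᵥ v with hu
  -- `re⟨u, Yv⟩ = ‖u‖²`
  have h1 : (star u ⬝ᵥ (Y *ᵥ v)).re = nsq u := by rw [← hu, star_dotProduct_self, Complex.ofReal_re]
  -- the two parallelogram pieces, from `re_form_sub_smul` at `Y = 1`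
  have e1 : ∀ s : ℝ, nsq (u - (s : ℂ) • v) = nsq u - 2 * s * (star u ⬝ᵥ v).re + s ^ 2 * nsq v := by
    intro s
    have h := re_form_sub_smul Matrix.isHermitian_one u v s
    simp only [Matrix.one_mulVec] at h
    rw [star_dotProduct_self, star_dotProduct_self, star_dotProduct_self, Complex.ofReal_re, Complex.ofReal_re,
      Complex.ofReal_re] at h
    exact h
  -- polarization: `Q(u − (−t)v) − Q(u − tv) = 4t·‖u‖²`, and the two-sided bound on the left
  have hpol : ∀ t : ℝ, 4 * t * nsq u ≤ 2 * K * (nsq u + t ^ 2 * nsq v) := by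
    intro t
    have p : (star (u - ((-t : ℝ) : ℂ) • v) ⬝ᵥ (Y *ᵥ (u - ((-t : ℝ) : ℂ) • v))).re
        - (star (u - (t : ℂ) • v) ⬝ᵥ (Y *ᵥ (u - (t : ℂ) • v))).re = 4 * t * nsq u := by
      rw [re_form_sub_smul hY, re_form_sub_smul hY, h1]
      ring
    have b1 := hup (u - ((-t : ℝ) : ℂ) • v)
    have b2 := hlo (u - (t : ℂ) • v)
    rw [e1] at b1 b2
    nlinarith [b1, b2, p]
  by_cases hK0 : K = 0
  · subst hK0
    have c := hpol 1
    nlinarith [nsq_nonneg u, nsq_nonneg v, c]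
  · have hKpos : 0 < K := lt_of_le_of_ne hK (Ne.symm hK0)
    have c := hpol K
    -- `4K‖u‖² ≤ 2K‖u‖² + 2K³‖v‖²`
    have key : K * (2 * nsq u) ≤ K * (2 * (K ^ 2 * nsq v)) := by nlinarith [c]
    have := le_of_mul_le_mul_left key hKpos
    linarith

section Region

variable (n : ℕ) [NeZero n] (M : Fin d → ℕ) [hM : ∀ μ, NeZero (M μ)] (S : Tor M → Prop) [DecidablePred S]

/-! ## §1 The corner weight; the weights-form bounds for every `n` -/

/-- **THE CORNER WEIGHT** of a bond: the number of its exterior endpoints having at least two `Ω`-neighbours (for a star bond `0` or `1`;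
`1` exactly on the bonds attached to a re-entrant corner / edge or a codimension-2 contact of `Ω`). [folklore] -/
def cornerWt (b : Tor (fine n M) × Fin d) : ℝ := bdW n M S (fun x => if 2 ≤ nbrCount n M S x then (1 : ℝ) else 0) b

/-- `0 ≤ cornerWt`. [folklore] -/
theorem cornerWt_nonneg (b : Tor (fine n M) × Fin d) : 0 ≤ cornerWt n M S b :=
  bdW_nonneg n M S (fun x _ => by split_ifs <;> norm_num) b

/-- a star bond has at most one exterior endpoint: `cornerWt ≤ 1` there. [folklore] -/
theorem cornerWt_le_one (y : {b // starReg n M S b}) : cornerWt n M S y.1 ≤ 1 :=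
  bdW_le_one_of_star n M S (fun x _ => by split_ifs <;> norm_num) y

/-- under H1 there are NO corner bonds. [folklore] -/
theorem cornerWt_eq_zero_of_atMostOne (hH : AtMostOneNeighbour n M S) (b : Tor (fine n M) × Fin d) : cornerWt n M S b = 0 := by
  rw [atMostOneNeighbour_iff] at hH
  unfold cornerWt
  rw [bdW_congr n M S (g₂ := fun _ => (0 : ℝ)) (fun x hx => by rw [if_neg (by have := hH x hx; omega)])]
  unfold bdW
  split_ifs <;> ring

/-- the real part of the corner form (file 6's `form_cornerC`, read in `ℝ`). [folklore] -/
theorem re_form_cornerC (A : {b // starReg n M S b} → ℂ) :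
    (star A ⬝ᵥ (cornerC n M S *ᵥ A)).re
      = (n : ℝ) ^ 2 * ∑ b : {b // starReg n M S b}, cnt1 n M S b.1.2 b.1 * ‖A b‖ ^ 2 - extFlux n M S A := by
  rw [form_cornerC, Complex.ofReal_re]

/-- **UPPER WEIGHTS-FORM BOUND** (any region, any `n`): `re⟨A, C A⟩ ≤ n²·Σ_y (cnt1 (y.2) y − bdW [nbrCount ≤ 1] y)·‖A y‖²`. [folklore] -/
theorem form_cornerC_le_weights (A : {b // starReg n M S b} → ℂ) :
    (star A ⬝ᵥ (cornerC n M S *ᵥ A)).re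
      ≤ (n : ℝ) ^ 2 * ∑ y : {b // starReg n M S b},
          (cnt1 n M S y.1.2 y.1 - bdW n M S (fun x => if nbrCount n M S x ≤ 1 then (1 : ℝ) else 0) y.1) * ‖A y‖ ^ 2 := by
  rw [re_form_cornerC]
  have h := extFlux_ge_isolated n M S A
  have e : ∑ y : {b // starReg n M S b},
      (cnt1 n M S y.1.2 y.1 - bdW n M S (fun x => if nbrCount n M S x ≤ 1 then (1 : ℝ) else 0) y.1) * ‖A y‖ ^ 2
        = ∑ y : {b // starReg n M S b}, cnt1 n M S y.1.2 y.1 * ‖A y‖ ^ 2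
          - ∑ y : {b // starReg n M S b}, bdW n M S (fun x => if nbrCount n M S x ≤ 1 then (1 : ℝ) else 0) y.1 * ‖A y‖ ^ 2 := by
    rw [← sum_sub_distrib]; exact sum_congr rfl fun y _ => by ring
  rw [e, mul_sub]
  linarith

/-- **LOWER WEIGHTS-FORM BOUND** (any region, any `n`): `n²·Σ_y (cnt1 (y.2) y − bdW nbrCount y)·‖A y‖² ≤ re⟨A, C A⟩`. [folklore] -/
theorem form_cornerC_ge_weights (A : {b // starReg n M S b} → ℂ) :
    (n : ℝ) ^ 2 * ∑ y : {b // starReg n M S b},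
        (cnt1 n M S y.1.2 y.1 - bdW n M S (fun x => (nbrCount n M S x : ℝ)) y.1) * ‖A y‖ ^ 2
      ≤ (star A ⬝ᵥ (cornerC n M S *ᵥ A)).re := by
  rw [re_form_cornerC]
  have h := extFlux_le_nbrCount n M S A
  have e : ∑ y : {b // starReg n M S b}, (cnt1 n M S y.1.2 y.1 - bdW n M S (fun x => (nbrCount n M S x : ℝ)) y.1) * ‖A y‖ ^ 2
        = ∑ y : {b // starReg n M S b}, cnt1 n M S y.1.2 y.1 * ‖A y‖ ^ 2
          - ∑ y : {b // starReg n M S b}, bdW n M S (fun x => (nbrCount n M S x : ℝ)) y.1 * ‖A y‖ ^ 2 := by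
    rw [← sum_sub_distrib]; exact sum_congr rfl fun y _ => by ring
  rw [e, mul_sub]
  linarith

/-! ## §2 At `2 ≤ n`: the own-direction charge is the boundary indicator, and the sharp ENDs -/

omit [DecidablePred S] in
/-- at `2 ≤ n`, the forward own-direction translate of a star bond fails to be star EXACTLY when its head is outside `Ω` (gen 8's
`not_star_add_iff` with H1 replaced by `2 ≤ n`). [folklore] -/
theorem not_star_add_iff_two_le [DecidablePred S] (hn : 2 ≤ n) (y : {b // starReg n M S b}) :
    ¬ starReg n M S (y.1.1 + unitVec (fine n M) y.1.2, y.1.2) ↔ ¬ blockReg n M S (y.1.1 + unitVec (fine n M) y.1.2) := by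
  obtain ⟨⟨x, ν⟩, hy⟩ := y
  constructor
  · intro hns hz
    exact hns (Or.inl (by simpa using hz))
  · intro hz
    have hx : blockReg n M S x := hy.resolve_right hz
    rintro (h1 | h2)
    · exact hz h1
    · refine not_nbr_both n M S hn hz ν ?_ ?_
      · simpa [add_assoc] using h2
      · simpa using hx

omit [DecidablePred S] in
/-- at `2 ≤ n`, the backward own-direction translate of a star bond fails to be star EXACTLY when its tail is outside `Ω`. [folklore] -/
theorem not_star_sub_iff_two_le [DecidablePred S] (hn : 2 ≤ n) (y : {b // starReg n M S b}) :
    ¬ starReg n M S (y.1.1 - unitVec (fine n M) y.1.2, y.1.2) ↔ ¬ blockReg n M S y.1.1 := by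
  obtain ⟨⟨x, ν⟩, hy⟩ := y
  constructor
  · intro hns hx
    exact hns (Or.inr (by simpa using hx))
  · intro hx
    have hz : blockReg n M S (x + unitVec (fine n M) ν) := hy.resolve_left hx
    rintro (h1 | h2)
    · exact not_nbr_both n M S hn hx ν hz (by simpa using h1)
    · simp only [sub_add_cancel] at h2; exact hx h2

/-- **AT `2 ≤ n` THE OWN-DIRECTION CHARGE IS THE BOUNDARY INDICATOR**: `cnt1 (y.2) y = [head ∉ Ω] + [tail ∉ Ω] = bdW 1 y` — no H1.
[folklore] -/
theorem cnt1_own_eq_bdW (hn : 2 ≤ n) (y : {b // starReg n M S b}) : cnt1 n M S y.1.2 y.1 = bdW n M S (fun _ => 1) y.1 := by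
  unfold cnt1 bdW
  have h1 := not_star_add_iff_two_le n M S hn y
  have h2 := not_star_sub_iff_two_le n M S hn y
  congr 1
  · by_cases hz : blockReg n M S (y.1.1 + unitVec (fine n M) y.1.2)
    · rw [if_pos hz, if_pos (not_not.mp (mt h1.mp (not_not.mpr hz)))]
    · rw [if_neg hz, if_neg (h1.mpr hz)]
  · by_cases hx : blockReg n M S y.1.1
    · rw [if_pos hx, if_pos (not_not.mp (mt h2.mp (not_not.mpr hx)))]
    · rw [if_neg hx, if_neg (h2.mpr hx)]

/-- **THE UPPER END**: at `2 ≤ n`, on any union of blocks, `re⟨A, C A⟩ ≤ n²·Σ_y cornerWt y·‖A y‖²` — the corner form is at most `n²` per unit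
mass on the corner bonds and nonpositive off them. [folklore] -/
theorem form_cornerC_le (hn : 2 ≤ n) (A : {b // starReg n M S b} → ℂ) :
    (star A ⬝ᵥ (cornerC n M S *ᵥ A)).re ≤ (n : ℝ) ^ 2 * ∑ y : {b // starReg n M S b}, cornerWt n M S y.1 * ‖A y‖ ^ 2 := by
  refine (form_cornerC_le_weights n M S A).trans (le_of_eq ?_)
  congr 1
  refine sum_congr rfl fun y _ => ?_
  rw [cnt1_own_eq_bdW n M S hn y, bdW_sub]
  congr 1
  exact bdW_congr n M S (fun x _ => by split_ifs <;> norm_num <;> omega) y.1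

/-- **THE LOWER END**: at `2 ≤ n`, on any union of blocks, `−(d − 1)·n²·Σ_y cornerWt y·‖A y‖² ≤ re⟨A, C A⟩` (truncated `d − 1`; each
exterior endpoint has at most `d` neighbours in `Ω`). [folklore] -/
theorem form_cornerC_ge (hn : 2 ≤ n) (A : {b // starReg n M S b} → ℂ) :
    -(((d - 1 : ℕ) : ℝ) * (n : ℝ) ^ 2 * ∑ y : {b // starReg n M S b}, cornerWt n M S y.1 * ‖A y‖ ^ 2)
      ≤ (star A ⬝ᵥ (cornerC n M S *ᵥ A)).re := by
  refine le_trans (le_of_eq ?_) ((mul_le_mul_of_nonneg_left (sum_le_sum fun y _ =>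
    mul_le_mul_of_nonneg_right (?_ : -((d - 1 : ℕ) : ℝ) * cornerWt n M S y.1
      ≤ cnt1 n M S y.1.2 y.1 - bdW n M S (fun x => (nbrCount n M S x : ℝ)) y.1) (sq_nonneg ‖A y‖)) (sq_nonneg (n : ℝ))).trans
    (form_cornerC_ge_weights n M S A))
  · rw [mul_sum, mul_sum, ← sum_neg_distrib]
    exact sum_congr rfl fun y _ => by ring
  · -- pointwise on the exterior: `−(d − 1)·[2 ≤ m] ≤ 1 − m` since `m ≤ d`
    rw [cnt1_own_eq_bdW n M S hn y, bdW_sub, cornerWt, mul_bdW]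
    refine bdW_mono n M S (fun x hx => ?_) y.1
    have hd := nbrCount_le n M S hn hx
    split_ifs with h2
    · have e : ((d - 1 : ℕ) : ℝ) = (d : ℝ) - 1 := by rw [Nat.cast_sub (by omega), Nat.cast_one]
      have : (nbrCount n M S x : ℝ) ≤ d := by exact_mod_cast hd
      rw [e, mul_one]
      linarith
    · have : (nbrCount n M S x : ℝ) ≤ 1 := by exact_mod_cast (by omega : nbrCount n M S x ≤ 1)
      rw [mul_zero]
      linarith

/-- **THE NORM END**: at `2 ≤ n`, on any union of blocks, `‖cornerC n M S‖ ≤ (d − 1)·n²` (truncated `d − 1`: for `d ≤ 1` an exterior site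
has at most one `Ω`-neighbour, H1 holds and `C = 0`). [folklore] -/
theorem opNorm_cornerC_le (hn : 2 ≤ n) : ‖cornerC n M S‖ ≤ ((d - 1 : ℕ) : ℝ) * (n : ℝ) ^ 2 := by
  rcases Nat.lt_or_ge d 2 with hd | hd
  · have hH : AtMostOneNeighbour n M S :=
      (atMostOneNeighbour_iff n M S).mpr fun x hx => (nbrCount_le n M S hn hx).trans (by omega)
    rw [cornerC_eq_zero n M S hH, norm_zero]
    positivity
  · have hK1 : (1 : ℝ) ≤ ((d - 1 : ℕ) : ℝ) := by exact_mod_cast (by omega : 1 ≤ d - 1)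
    have hn2 : (0 : ℝ) ≤ (n : ℝ) ^ 2 := sq_nonneg _
    have hcw : ∀ A : {b // starReg n M S b} → ℂ, ∑ y : {b // starReg n M S b}, cornerWt n M S y.1 * ‖A y‖ ^ 2 ≤ nsq A :=
      fun A => sum_le_sum fun y _ => by
        have := mul_le_mul_of_nonneg_right (cornerWt_le_one n M S y) (sq_nonneg ‖A y‖)
        rwa [one_mul] at this
    have hcw0 : ∀ A : {b // starReg n M S b} → ℂ, 0 ≤ ∑ y : {b // starReg n M S b}, cornerWt n M S y.1 * ‖A y‖ ^ 2 :=
      fun A => sum_nonneg fun y _ => mul_nonneg (cornerWt_nonneg n M S y.1) (sq_nonneg _)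
    refine opNorm_le_of_re_form_two_sided (cornerC_isHermitian n M S) (by positivity) (fun A => ?_) (fun A => ?_)
    · refine (form_cornerC_le n M S hn A).trans ?_
      calc (n : ℝ) ^ 2 * ∑ y : {b // starReg n M S b}, cornerWt n M S y.1 * ‖A y‖ ^ 2
          ≤ (n : ℝ) ^ 2 * nsq A := mul_le_mul_of_nonneg_left (hcw A) hn2
        _ = 1 * (n : ℝ) ^ 2 * nsq A := by ring
        _ ≤ ((d - 1 : ℕ) : ℝ) * (n : ℝ) ^ 2 * nsq A :=
            mul_le_mul_of_nonneg_right (mul_le_mul_of_nonneg_right hK1 hn2) (nsq_nonneg A)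
    · refine le_trans ?_ (form_cornerC_ge n M S hn A)
      have := mul_le_mul_of_nonneg_left (hcw A) (mul_nonneg (le_trans zero_le_one hK1) hn2)
      linarith

/-- hence, at `2 ≤ n`, the two-sided corner form in one `nsq` line: `|re⟨A, C A⟩| ≤ (d − 1)·n²·‖A‖²` is implied by the sharper pair
`−(d − 1)·n²·Σ_corner ≤ re⟨A, C A⟩ ≤ n²·Σ_corner`; recorded here is the cruder corner-free consequence `re⟨A, C A⟩ ≤ n²·‖A‖²`. [folklore] -/
theorem form_cornerC_le_nsq (hn : 2 ≤ n) (A : {b // starReg n M S b} → ℂ) :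
    (star A ⬝ᵥ (cornerC n M S *ᵥ A)).re ≤ (n : ℝ) ^ 2 * nsq A :=
  (form_cornerC_le n M S hn A).trans (mul_le_mul_of_nonneg_left (sum_le_sum fun y _ => by
    have := mul_le_mul_of_nonneg_right (cornerWt_le_one n M S y) (sq_nonneg ‖A y‖)
    rwa [one_mul] at this) (sq_nonneg _))

/-! ## §3 A consequence for W2 on the re-entrant front: the gradient energy of the zero extension, modulo the boundary-normal mass -/

/-- **THE EXTERIOR FLUX IS AT MOST `d·n²` TIMES THE BOUNDARY-NORMAL MASS** (any union of blocks, `2 ≤ n`): `extFlux A ≤ d·n²·Σ_y bdW 1 y·‖A y‖²`,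
`bdW 1 y = [head ∉ Ω] + [tail ∉ Ω]` (under H1 this is an EQUALITY with `d` replaced by `1`, gen 8's `extFlux_eq`). [folklore] -/
theorem extFlux_le_boundary (hn : 2 ≤ n) (A : {b // starReg n M S b} → ℂ) :
    extFlux n M S A ≤ (d : ℝ) * (n : ℝ) ^ 2 * ∑ y : {b // starReg n M S b}, bdW n M S (fun _ => 1) y.1 * ‖A y‖ ^ 2 := by
  refine (extFlux_le_nbrCount n M S A).trans ?_
  have hpt : ∀ y : {b // starReg n M S b},
      bdW n M S (fun x => (nbrCount n M S x : ℝ)) y.1 * ‖A y‖ ^ 2 ≤ ((d : ℝ) * bdW n M S (fun _ => 1) y.1) * ‖A y‖ ^ 2 := by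
    intro y
    refine mul_le_mul_of_nonneg_right ?_ (sq_nonneg _)
    rw [mul_bdW]
    refine bdW_mono n M S (fun x hx => ?_) y.1
    rw [mul_one]
    exact_mod_cast nbrCount_le n M S hn hx
  calc (n : ℝ) ^ 2 * ∑ y : {b // starReg n M S b}, bdW n M S (fun x => (nbrCount n M S x : ℝ)) y.1 * ‖A y‖ ^ 2
      ≤ (n : ℝ) ^ 2 * ∑ y : {b // starReg n M S b}, ((d : ℝ) * bdW n M S (fun _ => 1) y.1) * ‖A y‖ ^ 2 :=
        mul_le_mul_of_nonneg_left (sum_le_sum fun y _ => hpt y) (sq_nonneg _)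
    _ = (d : ℝ) * (n : ℝ) ^ 2 * ∑ y : {b // starReg n M S b}, bdW n M S (fun _ => 1) y.1 * ‖A y‖ ^ 2 := by
        rw [mul_sum, mul_sum]
        exact sum_congr rfl fun y _ => by ring

/-- **HENCE W2 ON ANY UNION OF BLOCKS REDUCES TO THE BOUNDARY-NORMAL MASS** (`2 ≤ n`): the gradient energy of the zero extension is the faithful
curl and divergence energies plus at most `d·n²` times the mass of `A` on the star bonds crossing `∂Ω` (gen 6's `gaffney_region` + `extFlux_le_boundary`)
— so a LINEAR-growth W2 constant follows from ONE trace-type bound `n·Σ_{∂} ‖A‖² ≤ C·re⟨A, Δ_a(Ω₀)A⟩`, with no corner condition on the region.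
[folklore] -/
theorem gradEnergy_le_boundary (hn : 2 ≤ n) (A : {b // starReg n M S b} → ℂ) :
    ∑ ν, nsq (fdiff (fine n M) (n : ℂ) ν *ᵥ ext (starReg n M S) A)
      ≤ nsq (curlR n M S *ᵥ A) + nsq ((gradR n M S)ᴴ *ᵥ A)
          + (d : ℝ) * (n : ℝ) ^ 2 * ∑ y : {b // starReg n M S b}, bdW n M S (fun _ => 1) y.1 * ‖A y‖ ^ 2 := by
  rw [← gaffney_region]
  have := extFlux_le_boundary n M S hn A
  linarith

/-- … and conversely (any `n`): the gradient energy of the zero extension DOMINATES the faithful energies plus `n²` times the mass on the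
ISOLATED boundary-normal bonds (exterior endpoint with at most one `Ω`-neighbour) — so, corners aside, a zero-extension W2 bound and a
boundary-normal trace bound are the same estimate. [folklore] -/
theorem isolated_boundary_le_gradEnergy (A : {b // starReg n M S b} → ℂ) :
    nsq (curlR n M S *ᵥ A) + nsq ((gradR n M S)ᴴ *ᵥ A)
        + (n : ℝ) ^ 2 * ∑ y : {b // starReg n M S b}, bdW n M S (fun x => if nbrCount n M S x ≤ 1 then (1 : ℝ) else 0) y.1 * ‖A y‖ ^ 2
      ≤ ∑ ν, nsq (fdiff (fine n M) (n : ℂ) ν *ᵥ ext (starReg n M S) A) := by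
  rw [← gaffney_region]
  have := extFlux_ge_isolated n M S A
  linarith

end Region

end Summit.QuantumFields.BalabanUV.T4Continuum.RegionCornerCoupling

end
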